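import Summits.ABC.IUTFork.Conditional.AbcOfSGenuineKChosenDepthHexSharp
import HarnessLib

/-!
# Branch C / R-W «HEX-SHARP», engine-free floor, II: the explicit thresholds for the other `l` of the HEX table
# (`l = 17: k ≥ 35`, `l = 19: k ≥ 34`, `l = 23: k ≥ 33`, `l = 29: k ≥ 34`, `l = 31: k ≥ 34`, `l = 37: k ≥ 33`)

PROOF-ONLY sequel (D-0012; 0 definitions, 0 `Prop` facts) of `AbcOfSGenuineKChosenDepthHexSharp` (abc-iut-rp-m4 gen 3, p454167: the floor-free
family test `Hex.tame_ineq_of_pow_lt`, the explicit-threshold family theorem `GenuineK.deep_place_lamSeven_of_threshold`, instances `l = 11`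
(`k ≥ 37`) and `l = 13` (`k ≥ 35`), and the per-datum refutation of S_H `GenuineK.not_pilotKummerCompatHull_lamSeven_of_threshold`). This file
only INSTANTIATES the family theorem at the six further primes `l` of R-W's HEX table (W-SPEC §5: `l ∈ {11,13,17,19,23,29,31,37}`); each
instance is the pair of decidable integer facts `46080·l(l−1)²(l+1) < 7^m` (`norm_num`) and `l·((j+1)(2+m)+1) < k·(j²−1)` for `k ≥ k₀(l)`
(`omega`), `j = (l−1)/2`. The per-datum `¬ Cor312Vol.PilotKummerCompatHull` at the window bed for these classes is
`GenuineK.not_pilotKummerCompatHull_lamSeven_of_threshold` applied to the same two facts (not restated per `l`). TAKES NO SIDE on [IUTchIII]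
Cor. 3.12 or on any author; refuted-as-typed at one deep packet ≠ refuted-in-print; nothing about the printed GLOBAL inequality; typed ≠ proved.

| `l` | `j = (l−1)/2` | `N_l = 46080·l(l−1)²(l+1)` | `m` (`N_l < 7^m`) | threshold `l·((j+1)(2+m)+1) < (j²−1)·k` | every `k ≥` |
|---|---|---|---|---|---|
| 17 | 8 | 3 609 722 880 | 12 | 2159 < 63·k | 35 |
| 19 | 9 | 5 673 369 600 | 12 | 2679 < 80·k | 34 |
| 23 | 11 | 12 311 101 440 | 12 | 3887 < 120·k | 33 |
| 29 | 14 | 31 430 246 400 | 13 | 6554 < 195·k | 34 |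
| 31 | 15 | 41 140 224 000 | 13 | 7471 < 224·k | 34 |
| 37 | 18 | 83 965 870 080 | 13 | 10582 < 323·k | 33 |

Plus a UNIVERSAL closed form for every prime `l ≥ 11` (`Hex.natBound_lt_pow`, `GenuineK.deep_place_lamSeven_of_ge`: `m = 10 + 4⌊log₇ l⌋`,
`k ≥ ⌊l·((j+1)(2+m)+1)/(j²−1)⌋ + 1`; coarser, e.g. `k ≥ 45` at `l = 11`). (Against `k ≳ 70–78` for the degree form `Hex.core_ineq`; the model-conditional exact thresholds of W-SPEC §5 are `k ≈ 8–10`.)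
[cite: Mochizuki2012, IUTchIII Cor. 3.12 Step (xi-f) p. 184; IUTchIV Prop. 1.2 p. 10, Cor. 2.2 (ii) proof (P5) p. 46] [claim: Mochizuki2012, status: disputed]
-/

noncomputable section

open Set Function NumberField IsDedekindDomain

namespace Summit.ABC.IUTFork.Conditional

open Thm311 Thm311.Real Cor312 Cor312Vol Cor312Prov Literature.IUT.LogThetaLattice Literature.IUT.LogVolume
  Literature.IUT.HodgeTheaters Literature.NumberTheory.DiophantineGeometry.GenEll Summit.ABC.ABC.Theorems

/-- **`l = 17`: every `k ≥ 35`** (`j = 8`; `N = 3 609 722 880 < 7^12`; threshold `2159 < 63·k ⟺ k ≥ 35`): at every genuine Θ-volume datum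
at `(ratPoint λ_k, 17)` the top-label packet over `7` satisfies the explicit depth inequality at the chosen realising q-idele.
[claim: Mochizuki2012, status: disputed] -/
theorem GenuineK.deep_place_lamSeven_seventeen {k : ℕ} (hk : 35 ≤ k)
    (T : Cor22.ThetaVolumeDatumAt (ratPoint ((2 : ℚ)⁻¹ + 2 / 7 ^ k)) 17) :
    letI := T.instFieldF; letI := T.instNumberFieldF; letI := T.instAlgebraF; letI := T.instFieldK
    letI := T.instNumberFieldK; letI := T.instAlgebraK; letI := T.instFieldFbar; letI := T.instAlgebraFbar
    letI := T.instAlgebraKFbar; letI := T.instIsElliptic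
    haveI : Fact (Nat.Prime 7) := ⟨by norm_num⟩
    ∃ (i : Fin (thetaIndex (pilotDataOfK T.D T.K)).lstar) (x₀ : (thetaIndex (pilotDataOfK T.D T.K)).Fibre (.inr ⟨7, by norm_num⟩)),
      (i : ℕ) = 7 ∧
      placeOf (pilotDataOfK T.D T.K) 7 x₀ ∈ (pilotDataOfK T.D T.K).S ∧
      (7 : ℝ) ^ ((((i : ℕ) : ℝ) + 2) * (differentOrd 7 (kOf (pilotDataOfK T.D T.K) 7 x₀)
          + logRadiusA 7 (absRamificationIdx 7 (kOf (pilotDataOfK T.D T.K) 7 x₀))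
          + logRadiusB 7 (absRamificationIdx 7 (kOf (pilotDataOfK T.D T.K) 7 x₀))) + 1) *
        ‖(exists_realising_qIdeles_pilotDataOfK T.D).choose ⟨7, by norm_num⟩ x₀‖ ^ (((i : ℕ) + 1) ^ 2 - 1) < 1 :=
  GenuineK.deep_place_lamSeven_of_threshold (m := 12) (by omega) (by norm_num) (by norm_num) (by norm_num) (by norm_num; omega) T

/-- **`l = 19`: every `k ≥ 34`** (`j = 9`; `N = 5 673 369 600 < 7^12`; threshold `2679 < 80·k ⟺ k ≥ 34`): at every genuine Θ-volume datum
at `(ratPoint λ_k, 19)` the top-label packet over `7` satisfies the explicit depth inequality at the chosen realising q-idele.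
[claim: Mochizuki2012, status: disputed] -/
theorem GenuineK.deep_place_lamSeven_nineteen {k : ℕ} (hk : 34 ≤ k)
    (T : Cor22.ThetaVolumeDatumAt (ratPoint ((2 : ℚ)⁻¹ + 2 / 7 ^ k)) 19) :
    letI := T.instFieldF; letI := T.instNumberFieldF; letI := T.instAlgebraF; letI := T.instFieldK
    letI := T.instNumberFieldK; letI := T.instAlgebraK; letI := T.instFieldFbar; letI := T.instAlgebraFbar
    letI := T.instAlgebraKFbar; letI := T.instIsElliptic
    haveI : Fact (Nat.Prime 7) := ⟨by norm_num⟩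
    ∃ (i : Fin (thetaIndex (pilotDataOfK T.D T.K)).lstar) (x₀ : (thetaIndex (pilotDataOfK T.D T.K)).Fibre (.inr ⟨7, by norm_num⟩)),
      (i : ℕ) = 8 ∧
      placeOf (pilotDataOfK T.D T.K) 7 x₀ ∈ (pilotDataOfK T.D T.K).S ∧
      (7 : ℝ) ^ ((((i : ℕ) : ℝ) + 2) * (differentOrd 7 (kOf (pilotDataOfK T.D T.K) 7 x₀)
          + logRadiusA 7 (absRamificationIdx 7 (kOf (pilotDataOfK T.D T.K) 7 x₀))
          + logRadiusB 7 (absRamificationIdx 7 (kOf (pilotDataOfK T.D T.K) 7 x₀))) + 1) *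
        ‖(exists_realising_qIdeles_pilotDataOfK T.D).choose ⟨7, by norm_num⟩ x₀‖ ^ (((i : ℕ) + 1) ^ 2 - 1) < 1 :=
  GenuineK.deep_place_lamSeven_of_threshold (m := 12) (by omega) (by norm_num) (by norm_num) (by norm_num) (by norm_num; omega) T

/-- **`l = 23`: every `k ≥ 33`** (`j = 11`; `N = 12 311 101 440 < 7^12`; threshold `3887 < 120·k ⟺ k ≥ 33`): at every genuine Θ-volume datum
at `(ratPoint λ_k, 23)` the top-label packet over `7` satisfies the explicit depth inequality at the chosen realising q-idele.
[claim: Mochizuki2012, status: disputed] -/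
theorem GenuineK.deep_place_lamSeven_twentythree {k : ℕ} (hk : 33 ≤ k)
    (T : Cor22.ThetaVolumeDatumAt (ratPoint ((2 : ℚ)⁻¹ + 2 / 7 ^ k)) 23) :
    letI := T.instFieldF; letI := T.instNumberFieldF; letI := T.instAlgebraF; letI := T.instFieldK
    letI := T.instNumberFieldK; letI := T.instAlgebraK; letI := T.instFieldFbar; letI := T.instAlgebraFbar
    letI := T.instAlgebraKFbar; letI := T.instIsElliptic
    haveI : Fact (Nat.Prime 7) := ⟨by norm_num⟩
    ∃ (i : Fin (thetaIndex (pilotDataOfK T.D T.K)).lstar) (x₀ : (thetaIndex (pilotDataOfK T.D T.K)).Fibre (.inr ⟨7, by norm_num⟩)),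
      (i : ℕ) = 10 ∧
      placeOf (pilotDataOfK T.D T.K) 7 x₀ ∈ (pilotDataOfK T.D T.K).S ∧
      (7 : ℝ) ^ ((((i : ℕ) : ℝ) + 2) * (differentOrd 7 (kOf (pilotDataOfK T.D T.K) 7 x₀)
          + logRadiusA 7 (absRamificationIdx 7 (kOf (pilotDataOfK T.D T.K) 7 x₀))
          + logRadiusB 7 (absRamificationIdx 7 (kOf (pilotDataOfK T.D T.K) 7 x₀))) + 1) *
        ‖(exists_realising_qIdeles_pilotDataOfK T.D).choose ⟨7, by norm_num⟩ x₀‖ ^ (((i : ℕ) + 1) ^ 2 - 1) < 1 :=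
  GenuineK.deep_place_lamSeven_of_threshold (m := 12) (by omega) (by norm_num) (by norm_num) (by norm_num) (by norm_num; omega) T

/-- **`l = 29`: every `k ≥ 34`** (`j = 14`; `N = 31 430 246 400 < 7^13`; threshold `6554 < 195·k ⟺ k ≥ 34`): at every genuine Θ-volume datum
at `(ratPoint λ_k, 29)` the top-label packet over `7` satisfies the explicit depth inequality at the chosen realising q-idele.
[claim: Mochizuki2012, status: disputed] -/
theorem GenuineK.deep_place_lamSeven_twentynine {k : ℕ} (hk : 34 ≤ k)
    (T : Cor22.ThetaVolumeDatumAt (ratPoint ((2 : ℚ)⁻¹ + 2 / 7 ^ k)) 29) :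
    letI := T.instFieldF; letI := T.instNumberFieldF; letI := T.instAlgebraF; letI := T.instFieldK
    letI := T.instNumberFieldK; letI := T.instAlgebraK; letI := T.instFieldFbar; letI := T.instAlgebraFbar
    letI := T.instAlgebraKFbar; letI := T.instIsElliptic
    haveI : Fact (Nat.Prime 7) := ⟨by norm_num⟩
    ∃ (i : Fin (thetaIndex (pilotDataOfK T.D T.K)).lstar) (x₀ : (thetaIndex (pilotDataOfK T.D T.K)).Fibre (.inr ⟨7, by norm_num⟩)),
      (i : ℕ) = 13 ∧
      placeOf (pilotDataOfK T.D T.K) 7 x₀ ∈ (pilotDataOfK T.D T.K).S ∧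
      (7 : ℝ) ^ ((((i : ℕ) : ℝ) + 2) * (differentOrd 7 (kOf (pilotDataOfK T.D T.K) 7 x₀)
          + logRadiusA 7 (absRamificationIdx 7 (kOf (pilotDataOfK T.D T.K) 7 x₀))
          + logRadiusB 7 (absRamificationIdx 7 (kOf (pilotDataOfK T.D T.K) 7 x₀))) + 1) *
        ‖(exists_realising_qIdeles_pilotDataOfK T.D).choose ⟨7, by norm_num⟩ x₀‖ ^ (((i : ℕ) + 1) ^ 2 - 1) < 1 :=
  GenuineK.deep_place_lamSeven_of_threshold (m := 13) (by omega) (by norm_num) (by norm_num) (by norm_num) (by norm_num; omega) T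

/-- **`l = 31`: every `k ≥ 34`** (`j = 15`; `N = 41 140 224 000 < 7^13`; threshold `7471 < 224·k ⟺ k ≥ 34`): at every genuine Θ-volume datum
at `(ratPoint λ_k, 31)` the top-label packet over `7` satisfies the explicit depth inequality at the chosen realising q-idele.
[claim: Mochizuki2012, status: disputed] -/
theorem GenuineK.deep_place_lamSeven_thirtyone {k : ℕ} (hk : 34 ≤ k)
    (T : Cor22.ThetaVolumeDatumAt (ratPoint ((2 : ℚ)⁻¹ + 2 / 7 ^ k)) 31) :
    letI := T.instFieldF; letI := T.instNumberFieldF; letI := T.instAlgebraF; letI := T.instFieldK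
    letI := T.instNumberFieldK; letI := T.instAlgebraK; letI := T.instFieldFbar; letI := T.instAlgebraFbar
    letI := T.instAlgebraKFbar; letI := T.instIsElliptic
    haveI : Fact (Nat.Prime 7) := ⟨by norm_num⟩
    ∃ (i : Fin (thetaIndex (pilotDataOfK T.D T.K)).lstar) (x₀ : (thetaIndex (pilotDataOfK T.D T.K)).Fibre (.inr ⟨7, by norm_num⟩)),
      (i : ℕ) = 14 ∧
      placeOf (pilotDataOfK T.D T.K) 7 x₀ ∈ (pilotDataOfK T.D T.K).S ∧
      (7 : ℝ) ^ ((((i : ℕ) : ℝ) + 2) * (differentOrd 7 (kOf (pilotDataOfK T.D T.K) 7 x₀)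
          + logRadiusA 7 (absRamificationIdx 7 (kOf (pilotDataOfK T.D T.K) 7 x₀))
          + logRadiusB 7 (absRamificationIdx 7 (kOf (pilotDataOfK T.D T.K) 7 x₀))) + 1) *
        ‖(exists_realising_qIdeles_pilotDataOfK T.D).choose ⟨7, by norm_num⟩ x₀‖ ^ (((i : ℕ) + 1) ^ 2 - 1) < 1 :=
  GenuineK.deep_place_lamSeven_of_threshold (m := 13) (by omega) (by norm_num) (by norm_num) (by norm_num) (by norm_num; omega) T

/-- **`l = 37`: every `k ≥ 33`** (`j = 18`; `N = 83 965 870 080 < 7^13`; threshold `10582 < 323·k ⟺ k ≥ 33`): at every genuine Θ-volume datum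
at `(ratPoint λ_k, 37)` the top-label packet over `7` satisfies the explicit depth inequality at the chosen realising q-idele.
[claim: Mochizuki2012, status: disputed] -/
theorem GenuineK.deep_place_lamSeven_thirtyseven {k : ℕ} (hk : 33 ≤ k)
    (T : Cor22.ThetaVolumeDatumAt (ratPoint ((2 : ℚ)⁻¹ + 2 / 7 ^ k)) 37) :
    letI := T.instFieldF; letI := T.instNumberFieldF; letI := T.instAlgebraF; letI := T.instFieldK
    letI := T.instNumberFieldK; letI := T.instAlgebraK; letI := T.instFieldFbar; letI := T.instAlgebraFbar
    letI := T.instAlgebraKFbar; letI := T.instIsElliptic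
    haveI : Fact (Nat.Prime 7) := ⟨by norm_num⟩
    ∃ (i : Fin (thetaIndex (pilotDataOfK T.D T.K)).lstar) (x₀ : (thetaIndex (pilotDataOfK T.D T.K)).Fibre (.inr ⟨7, by norm_num⟩)),
      (i : ℕ) = 17 ∧
      placeOf (pilotDataOfK T.D T.K) 7 x₀ ∈ (pilotDataOfK T.D T.K).S ∧
      (7 : ℝ) ^ ((((i : ℕ) : ℝ) + 2) * (differentOrd 7 (kOf (pilotDataOfK T.D T.K) 7 x₀)
          + logRadiusA 7 (absRamificationIdx 7 (kOf (pilotDataOfK T.D T.K) 7 x₀))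
          + logRadiusB 7 (absRamificationIdx 7 (kOf (pilotDataOfK T.D T.K) 7 x₀))) + 1) *
        ‖(exists_realising_qIdeles_pilotDataOfK T.D).choose ⟨7, by norm_num⟩ x₀‖ ^ (((i : ℕ) + 1) ^ 2 - 1) < 1 :=
  GenuineK.deep_place_lamSeven_of_threshold (m := 13) (by omega) (by norm_num) (by norm_num) (by norm_num) (by norm_num; omega) T

/-! ## A closed form for EVERY prime `l ≥ 11` (coarser, universal): `m(l) = 10 + 4·⌊log₇ l⌋`, `k ≥ ⌊l·((j+1)(12 + 4⌊log₇ l⌋) + 1)/(j²−1)⌋ + 1` -/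

/-- `46080·l(l−1)²(l+1) < 7^{10 + 4·⌊log₇ l⌋}` for every `l ≥ 1` (`46080·l(l−1)²(l+1) ≤ 92160·l⁴ < 7⁶·l⁴ ≤ 7⁶·(7^{⌊log₇ l⌋+1})⁴`). [folklore] -/
theorem Hex.natBound_lt_pow (l : ℕ) (hl : 1 ≤ l) : 46080 * (l * (l - 1) ^ 2 * (l + 1)) < 7 ^ (10 + 4 * Nat.log 7 l) := by
  have h1 : (l - 1) ^ 2 ≤ l ^ 2 := Nat.pow_le_pow_left (by omega) 2
  have h2 : l + 1 ≤ 2 * l := by omega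
  have hl4 : 0 < l ^ 4 := by positivity
  have hlog : l < 7 ^ (Nat.log 7 l + 1) := Nat.lt_pow_succ_log_self (by norm_num) l
  have hlog4 : l ^ 4 < (7 ^ (Nat.log 7 l + 1)) ^ 4 := Nat.pow_lt_pow_left hlog (by norm_num)
  calc 46080 * (l * (l - 1) ^ 2 * (l + 1)) ≤ 46080 * (l * l ^ 2 * (2 * l)) := by gcongr
    _ = 92160 * l ^ 4 := by ring
    _ < 117649 * l ^ 4 := by omega
    _ ≤ 117649 * (7 ^ (Nat.log 7 l + 1)) ^ 4 := Nat.mul_le_mul_left _ hlog4.le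
    _ = 7 ^ (10 + 4 * Nat.log 7 l) := by
        rw [show (117649 : ℕ) = 7 ^ 6 by norm_num, ← pow_mul, ← pow_add]; congr 1; ring

/-- **UNIVERSAL EXPLICIT THRESHOLD (every prime `l ≥ 11`).** With `j = (l−1)/2`, `m = 10 + 4·⌊log₇ l⌋` and
`k ≥ ⌊l·((j+1)(2+m) + 1)/(j²−1)⌋ + 1`, every genuine Θ-volume datum at `(ratPoint λ_k, l)` has an explicitly deep top-label packet over `7`
(coarser than the per-`l` instances — e.g. `l = 11`: `k ≥ 45` instead of `37` — but one statement for the infinite family in `l` AND `k`).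
[claim: Mochizuki2012, status: disputed] -/
theorem GenuineK.deep_place_lamSeven_of_ge {k l : ℕ} (hl : l.Prime) (h11 : 11 ≤ l)
    (hk : l * (((l - 1) / 2 + 1) * (2 + (10 + 4 * Nat.log 7 l)) + 1) / (((l - 1) / 2) ^ 2 - 1) + 1 ≤ k)
    (T : Cor22.ThetaVolumeDatumAt (ratPoint ((2 : ℚ)⁻¹ + 2 / 7 ^ k)) l) :
    letI := T.instFieldF; letI := T.instNumberFieldF; letI := T.instAlgebraF; letI := T.instFieldK
    letI := T.instNumberFieldK; letI := T.instAlgebraK; letI := T.instFieldFbar; letI := T.instAlgebraFbar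
    letI := T.instAlgebraKFbar; letI := T.instIsElliptic
    haveI : Fact (Nat.Prime 7) := ⟨by norm_num⟩
    ∃ (i : Fin (thetaIndex (pilotDataOfK T.D T.K)).lstar) (x₀ : (thetaIndex (pilotDataOfK T.D T.K)).Fibre (.inr ⟨7, by norm_num⟩)),
      (i : ℕ) = (l - 1) / 2 - 1 ∧
      placeOf (pilotDataOfK T.D T.K) 7 x₀ ∈ (pilotDataOfK T.D T.K).S ∧
      (7 : ℝ) ^ ((((i : ℕ) : ℝ) + 2) * (differentOrd 7 (kOf (pilotDataOfK T.D T.K) 7 x₀)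
          + logRadiusA 7 (absRamificationIdx 7 (kOf (pilotDataOfK T.D T.K) 7 x₀))
          + logRadiusB 7 (absRamificationIdx 7 (kOf (pilotDataOfK T.D T.K) 7 x₀))) + 1) *
        ‖(exists_realising_qIdeles_pilotDataOfK T.D).choose ⟨7, by norm_num⟩ x₀‖ ^ (((i : ℕ) + 1) ^ 2 - 1) < 1 := by
  have hb : 0 < ((l - 1) / 2) ^ 2 - 1 := by
    have h5 : 5 ≤ (l - 1) / 2 := by omega
    have : 25 ≤ ((l - 1) / 2) ^ 2 := by nlinarith
    omega
  have hlt : l * (((l - 1) / 2 + 1) * (2 + (10 + 4 * Nat.log 7 l)) + 1) < k * (((l - 1) / 2) ^ 2 - 1) :=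
    lt_of_lt_of_le (Nat.lt_div_mul_add hb) (by
      have := Nat.mul_le_mul_right (((l - 1) / 2) ^ 2 - 1) hk
      simpa [Nat.add_mul] using this)
  exact GenuineK.deep_place_lamSeven_of_threshold (m := 10 + 4 * Nat.log 7 l) (le_trans (Nat.le_add_left 1 _) hk) hl h11
    (Hex.natBound_lt_pow l (by omega)) hlt T

end Summit.ABC.IUTFork.Conditional

end
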